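import Summits.KontsevichZagierPeriods.KontsevichZagierPeriods.Theses.PhiFourHepp
import Literature.MathematicalPhysics.QuantumFieldTheory.GraphPeriodProofs
import Literature.MathematicalPhysics.QuantumFieldTheory.GraphPeriodHeppBound
import Literature.MathematicalPhysics.QuantumFieldTheory.HeppBoundFlagFormula
import Literature.NumberTheory.Transcendental.KZLogCalculusProofs

/-!
# `TropicalLifting` (stmt-KontsevichZagierPeriods-12289, route PhiFourHepp, crux rank 4) — birth skeleton

Crux (the route's BET, "`S_H ⊆ KZ.relations`"): for ALL edge lists `E₁ : Fin (2k₁+2) → Fin (k₁+2)²`,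
`E₂ : Fin (2k₂+2) → Fin (k₂+2)²` with every vertex degree `≤ 4`, any two KZ integral representations
`r₁, r₂` pinned as the parametric Feynman integrals `[(0,∞)^{2kᵢ+1}, 1/Ψ_{Eᵢ}(x,1)²]` (determinantal
Kirchhoff polynomial) whose INLINED Hepp flag sums agree are `KZ.Equivalent`.

The typed class is broader than "φ⁴ graph": it admits disconnected lists (then `Ψ ≡ 0`, the integrand is
the junk `1/0² = 0`, representations exist and are ZERO, and the inlined Hepp sum is `0`), and lists with
self-loops / multi-edges / subdivergences (then `1/Ψ(x,1)²` is not integrable on the orthant and NO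
representation exists).  The line registered here — "reduction to the primitive locus inside the
calculus, then tropical lifting on primitive φ⁴ graphs" — makes that audit (refuters g43-18, g44-29,
g44-58, rattack-12289, 2026-08-15) a kernel-checked part of the proof and hands the open content to the
provers over the tree's vocabulary (`Literature/MathematicalPhysics/QuantumFieldTheory/GraphPeriod.lean`,
`HeppBound.lean`, `HeppBoundFlagFormula.lean`):

* `stub_noSubdivergence_of_integrable` — ANALYSIS (power counting, the "only if" half of the convergence
  criterion): if `E` is connected and `1/Ψ_E(x,1)²` is absolutely integrable on the open orthant, then
  every non-empty proper edge set `γ` has `|γ| > 2 h₁(γ)` (no subdivergence).  Panzer2022 Prop. 2.9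
  (the Mellin integral (2.1) converges precisely on the cone `ω(γ) > 0`, here `a⃗ = 1⃗`, `D = 4`,
  `ω(γ) = |γ| - 2h₁(γ)`); BlochEsnaultKreimer2006 Prop. 5.2 / Lemma 6.1; Weinberg 1960; Speer 1975.
  The converse half is the tree's `graphPeriod_convergent_of_isPrimitiveDivergent_holds`.
* `stub_inlineHepp_eq_flagSum` — CALIBRATION of the route's inlined formula: for a connected list of the
  crux's shape (so `h₁(E) = k+1`), the inlined sum over `c : Fin (k+1) → Finset` (full incidence ranks
  over all `k+2` vertex columns, bridgelessness as "rank does not drop", loop numbers `|c i| - rk = i+1`)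
  IS the tree's bridgeless-flag sum `graphUnitHeppFlagSum E` (Panzer2022 Prop. 3.2 right-hand side,
  flags `γ : Fin (h₁+2) → Finset` with `γ 0 = ∅`, reduced incidence ranks).  A re-indexing identity
  (`γ = Fin.cons ∅ c`; full rank = reduced rank because incidence rows sum to zero); with the tree's
  `graphUnitHeppBound_eq_graphUnitHeppFlagSum` (Prop. 3.2, PROVED) it identifies the inlined number
  with Panzer's `H(G)` of Def. 2.4 on primitive-divergent lists.  The route's support item `HeppK4`
  (`= 84`) is its `k = 2` instance.
* `stub_lifting_primitive` — THE BET on its meaningful locus: for φ⁴ (`IsPhiFour`), connected,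
  primitive-divergent `E₁, E₂`, representations pinned as `graphPeriodIntegrand Eᵢ` on `openOrthant`,
  `graphUnitHeppBound E₁ = graphUnitHeppBound E₂ → KZ.Equivalent r₁ r₂` (Panzer2022 Conj. 1.2 `⇐`
  UPGRADED from equal values to a chain of moves; mechanism: a weight-preserving correspondence of
  bridgeless-flag sectors lifted cone by cone to monomial changes of Schwinger variables + additivity).

Shape (the registered-skeleton convention of `#h21_check_skeleton`): the three stub STATEMENTS are the named
Props `NoSubdivergenceOfIntegrable`, `InlineHeppCalibration`, `PrimitiveLifting` of §1 (`@[stub "birth"]`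
obligation nodes — the tag is a comment in this tree copy: crux workfiles may not carry gate-reserved
attributes); the stubs proper are `theorem stub_<name> : <StatementProp> := by sorry` (§2, the ONLY
sorries of the file); the composition `TropicalLifting_of : NoSubdivergenceOfIntegrable →
InlineHeppCalibration → PrimitiveLifting → TropicalLifting` (§4) is sorry-free and CLOSED (axioms ⊆ {propext,
Classical.choice, Quot.sound}) and concludes the crux BY ITS ROUTE NAME — it is definitionally the
verbatim-unfolded `TropicalLifting_unfolded_of` (same binders, conclusion = the crux text copied from the route
file); the registered target `TropicalLifting_ofStubs : TropicalLifting := TropicalLifting_of stub₁ stub₂ stub₃`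
takes NO hypotheses (its `#print axioms` reaches `sorryAx` exactly through the three stubs).  What the composition PROVES:
(a) `Ψ_E(x) = det M_E(x) = 0` for every disconnected `E` (a rational kernel vector of the reduced
incidence matrix is a kernel vector `(0, u)` of Brown's graph matrix), hence a representation pinned on a
disconnected list has integrand `0` on its domain and is a relation (`KZ.of_mem_relations_of_eqOn_zero`);
(b) the inlined Hepp sum of a disconnected list is `0` (its last-flag condition `|E| - rk_full(E) = k+1`
forces `rk ℰ_E = k+1`, because the γ-rows of the full incidence matrix factor through the reduced one:
`F_γ = ℰ_γ · Q`, so `rk F_γ ≤ rk ℰ ≤ k+1`); (c) Euler: a connected list of the crux's shape is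
logarithmically divergent, `2k+2 = 2 h₁(E)`, so with stub 1 it is primitive divergent; (d) Panzer §2.5:
on a primitive-divergent list the Hepp bound of Def. 2.4 is a sum of `(2k+2)!` products of POSITIVE
inverse degrees of convergence (`graphSdc_four_one_pos`), hence `0 < graphUnitHeppBound E`; (e) the
four-way case analysis on connectivity: both connected ⇒ stub 3 (Hepp sums calibrated by stub 2 and the
tree's Prop. 3.2); mixed ⇒ impossible (`0 < H(E₁) = inlined(E₁) = inlined(E₂) = 0`); both disconnected
⇒ both representations are relations, so is their difference.

Disproof used: none on file (`ledger crux ls stmt-KontsevichZagierPeriods-12289`: no workfiles, no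
`Disproof.lean`, no landed `Theorems/TropicalLifting/Negative/*`; `ledger negatives`: nothing on graph
periods).  All statements are over existing declarations only.
-/

noncomputable section

set_option linter.dupNamespace false

namespace Summit.KontsevichZagierPeriods.KontsevichZagierPeriods.Cruxes.TropicalLifting.Birth

open scoped BigOperators Classical Matrix
open Set MeasureTheory
open Literature.NumberTheory.Transcendental
open Literature.NumberTheory.Transcendental.KZ
open Literature.MathematicalPhysics.QuantumFieldTheory
open Literature.Combinatorics.Matroid (mem_orderings_iff)
open Summit.KontsevichZagierPeriods.KontsevichZagierPeriods.Theses.PhiFourHepp (TropicalLifting)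

/-! ## §1 The three stub STATEMENTS (named Props; `@[stub "birth"]` obligation nodes = the admissible
hypotheses of `TropicalLifting_of`) -/

/-- **Stub 1 statement** (ANALYSIS — absolute convergence forces primitivity; Panzer2022 Prop. 2.9 "only if" at
`a⃗ = 1⃗, D = 4`; BlochEsnaultKreimer2006 Prop. 5.2; Weinberg's power counting).  For a CONNECTED edge
list with `2k+2` edges on `k+2` vertices: if `x ↦ 1/Ψ_E(x,1)²` is integrable on the open orthant
`(0,∞)^{2k+1}`, then every non-empty proper edge set `γ` satisfies `2 h₁(γ) < |γ|` (scaling `x_γ = λy`,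
`λ → 0`, gives `∫ λ^{|γ|-2h₁(γ)-1} dλ`; if `γ` contains the pinned last edge, scale the complement to
`∞`).  Size L.  `@[stub "birth"]` obligation node; the sorry lives in `stub_noSubdivergence_of_integrable` only. -/
-- @[stub "birth"]   (gate-reserved attribute: `crux write` refuses it in workfiles, so it is a comment in this tree copy)
def NoSubdivergenceOfIntegrable : Prop :=
    ∀ (k : ℕ) (E : Fin (2*k+2) → Fin (k+2) × Fin (k+2)),
      IsConnectedEdgeList E →
      IntegrableOn (graphPeriodIntegrand E) (openOrthant (2*k+1)) →
      ∀ γ : Finset (Fin (2*k+2)), γ.Nonempty → γ ≠ Finset.univ → 2 * loopNumber E γ < γ.card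

/-- **Stub 2 statement** (CALIBRATION — the route's inlined flag formula is the tree's bridgeless-flag sum;
Panzer2022 Prop. 3.2, right-hand side).  For a CONNECTED edge list of the crux's shape the inlined
rational number (sum over `c : Fin (k+1) → Finset (Fin (2k+2))`, full-incidence ranks) equals
`graphUnitHeppFlagSum E` (sum over flags `Fin (h₁(E)+2) → Finset` with `γ 0 = ∅`, corank of the cycle
matroid): re-index by `γ = Fin.cons ∅ c`, full rank = reduced rank (rows of the incidence matrix sum to
zero), "rank does not drop" = "loop number drops", `h₁(E) = k+1` for connected `E`.  Size M.  `@[stub "birth"]` obligation node; the sorry lives in `stub_inlineHepp_eq_flagSum` only. -/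
-- @[stub "birth"]   (gate-reserved attribute: `crux write` refuses it in workfiles, so it is a comment in this tree copy)
def InlineHeppCalibration : Prop :=
    ∀ (k : ℕ) (E : Fin (2*k+2) → Fin (k+2) × Fin (k+2)),
      IsConnectedEdgeList E →
      (∑ c : Fin (k+1) → Finset (Fin (2*k+2)), if ((∀ i : Fin (k+1), (c i).Nonempty ∧ (∀ e ∈ c i,
        (Matrix.of fun (p : {p // p ∈ (c i).erase e}) (v : Fin (k+2)) => ((if (E p.1).1 = v then (1:ℚ) else
        0) - (if (E p.1).2 = v then (1:ℚ) else 0))).rank = (Matrix.of fun (p : {p // p ∈ c i}) (v : Fin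
        (k+2)) => ((if (E p.1).1 = v then (1:ℚ) else 0) - (if (E p.1).2 = v then (1:ℚ) else 0))).rank) ∧ (c
        i).card - (Matrix.of fun (p : {p // p ∈ c i}) (v : Fin (k+2)) => ((if (E p.1).1 = v then (1:ℚ) else
        0) - (if (E p.1).2 = v then (1:ℚ) else 0))).rank = i.val + 1) ∧ (∀ i j : Fin (k+1), i < j → c i ⊂ c
        j) ∧ c (Fin.last k) = Finset.univ) then ((c 0).card : ℚ) * (∏ i : Fin k, (((c i.succ).card : ℚ) -
        ((c i.castSucc).card : ℚ))) / (∏ i : Fin k, (((c i.castSucc).card : ℚ) - 2 * ((i.val : ℚ) + 1)))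
        else 0)
        = graphUnitHeppFlagSum E

/-- **Stub 3 statement** (THE BET on the primitive locus — tropical lifting; Panzer2022 Conj. 1.2 `⇐` upgraded to
moves, Thm 1.1, Prop. 3.2, §5.2; PanzerYeats2025 Conj. 1.10 / Table 3; Schnetz2010 §2).  For φ⁴,
connected, primitive-divergent edge lists `E₁, E₂` and representations pinned as the parametric integrals
`[(0,∞)^{2kᵢ+1}, 1/Ψ_{Eᵢ}(x,1)²]`: `H(E₁) = H(E₂)` (Panzer's Hepp bound, Def. 2.4 at unit indices in
`D = 4`) implies `KZ.Equivalent r₁ r₂`.  Open problem (contains Conj. 1.2 `⇐` by soundness).  `@[stub "birth"]` obligation node; the sorry lives in `stub_lifting_primitive` only. -/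
-- @[stub "birth"]   (gate-reserved attribute: `crux write` refuses it in workfiles, so it is a comment in this tree copy)
def PrimitiveLifting : Prop :=
    ∀ (k₁ k₂ : ℕ) (E₁ : Fin (2*k₁+2) → Fin (k₁+2) × Fin (k₁+2))
      (E₂ : Fin (2*k₂+2) → Fin (k₂+2) × Fin (k₂+2)),
      IsPhiFour E₁ → IsPhiFour E₂ →
      IsConnectedEdgeList E₁ → IsPrimitiveDivergent E₁ →
      IsConnectedEdgeList E₂ → IsPrimitiveDivergent E₂ →
      ∀ (r₁ : Literature.NumberTheory.Transcendental.KZ.IntegralRep (2*k₁+1))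
        (r₂ : Literature.NumberTheory.Transcendental.KZ.IntegralRep (2*k₂+1)),
        r₁.domain = openOrthant (2*k₁+1) →
        Set.EqOn r₁.integrand (graphPeriodIntegrand E₁) r₁.domain →
        r₂.domain = openOrthant (2*k₂+1) →
        Set.EqOn r₂.integrand (graphPeriodIntegrand E₂) r₂.domain →
        graphUnitHeppBound E₁ = graphUnitHeppBound E₂ →
        Literature.NumberTheory.Transcendental.KZ.Equivalent r₁ r₂

/-! ## §2 The three registered STUBS (the only sorries of the file) -/

/-- Stub 1: no subdivergence from absolute convergence (statement `NoSubdivergenceOfIntegrable`). -/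
theorem stub_noSubdivergence_of_integrable : NoSubdivergenceOfIntegrable := by
  sorry

/-- Stub 2: the inlined Hepp sum is the tree's bridgeless-flag sum (statement `InlineHeppCalibration`). -/
theorem stub_inlineHepp_eq_flagSum : InlineHeppCalibration := by
  sorry

/-- Stub 3: tropical lifting on the primitive φ⁴ locus (statement `PrimitiveLifting`; the bet). -/
theorem stub_lifting_primitive : PrimitiveLifting := by
  sorry

/-! ## §3 Glue, part 1: the incidence matrix (sorry-free) -/

section Incidence

variable {N V : ℕ}

/-- Rows of the full signed incidence matrix sum to zero. [folklore] -/
theorem sum_fullIncidence_row (s t : Fin (V + 1)) :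
    (∑ v : Fin (V + 1), ((if s = v then (1:ℚ) else 0) - (if t = v then (1:ℚ) else 0))) = 0 := by
  rw [Finset.sum_sub_distrib, Finset.sum_ite_eq, Finset.sum_ite_eq]
  simp

/-- **A disconnected edge list has identically vanishing Kirchhoff determinant** (Brown 2009,
Prop. 21: `Ψ_G = det M_G = 0` if `G` is not connected): a non-zero rational kernel vector `u` of the
reduced incidence matrix (`rk ℰ < V`) gives the kernel vector `(0, u)` of the graph matrix
`[[diag x, ℰ], [-ℰᵀ, 0]]`. [cite: Brown2009FeynmanPeriods, Prop. 21] -/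
theorem kirchhoffEval_eq_zero_of_not_connected (E : Fin N → Fin (V + 1) × Fin (V + 1))
    (hE : ¬ IsConnectedEdgeList E) (x : Fin N → ℝ) : kirchhoffEval E x = 0 := by
  have hlt : (reducedIncidence ℚ E).rank < V := lt_of_le_of_ne (Matrix.rank_le_width _) hE
  have hsum := LinearMap.finrank_range_add_finrank_ker (reducedIncidence ℚ E).mulVecLin
  rw [Module.finrank_fin_fun] at hsum
  have hrk : Module.finrank ℚ (LinearMap.range (reducedIncidence ℚ E).mulVecLin) =
      (reducedIncidence ℚ E).rank := rfl
  have hker : LinearMap.ker (reducedIncidence ℚ E).mulVecLin ≠ ⊥ := by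
    intro hbot
    rw [hbot, finrank_bot, hrk] at hsum
    omega
  obtain ⟨u, hu, hu0⟩ := Submodule.exists_mem_ne_zero_of_ne_bot hker
  rw [LinearMap.mem_ker, Matrix.mulVecLin_apply] at hu
  -- transport the kernel vector to `ℝ`
  have huR : reducedIncidence ℝ E *ᵥ (fun j => ((u j : ℚ) : ℝ)) = 0 := by
    have h1 : (reducedIncidence ℚ E).map (Rat.castHom ℝ) *ᵥ (⇑(Rat.castHom ℝ) ∘ u) = 0 := by
      funext e
      rw [← RingHom.map_mulVec, hu]
      simp
    rw [reducedIncidence_map] at h1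
    exact h1
  have hv0 : (Sum.elim (0 : Fin N → ℝ) (fun j => ((u j : ℚ) : ℝ))) ≠ 0 := by
    intro h0
    apply hu0
    funext j
    have h1 := congr_fun h0 (Sum.inr j)
    simp only [Sum.elim_inr, Pi.zero_apply] at h1
    exact_mod_cast h1
  unfold kirchhoffEval
  refine Matrix.exists_mulVec_eq_zero_iff.mp ⟨_, hv0, ?_⟩
  rw [graphMatrix, Matrix.fromBlocks_mulVec, Sum.elim_comp_inl, Sum.elim_comp_inr, Matrix.mulVec_zero,
    Matrix.mulVec_zero, Matrix.zero_mulVec, huR, add_zero, zero_add]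
  funext i
  cases i <;> rfl

/-- Hence the parametric integrand `1/Ψ_E(x,1)²` of a disconnected list is the junk value `0`. [folklore] -/
theorem graphPeriodIntegrand_eq_zero_of_not_connected {n : ℕ} (E : Fin (n + 1) → Fin (V + 1) × Fin (V + 1))
    (hE : ¬ IsConnectedEdgeList E) (x : Fin n → ℝ) : graphPeriodIntegrand E x = 0 := by
  rw [graphPeriodIntegrand, kirchhoffEval_eq_zero_of_not_connected E hE]
  simp

end Incidence

/-! ## §3 Glue, part 2: the inlined Hepp sum off and on the connected locus (sorry-free) -/

section Hepp

variable {k : ℕ}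

/-- The `γ`-rows of the FULL signed incidence matrix (all `k+2` vertex columns, as inlined by the crux)
factor through the reduced incidence matrix `ℰ` (column of vertex `0` deleted): `F_γ = ℰ_γ · Q` with
`Q = [-𝟙 | I]`, because every incidence row sums to zero; hence `rk F_γ ≤ rk ℰ`. [folklore] -/
theorem rank_fullRows_le (E : Fin (2*k+2) → Fin (k+2) × Fin (k+2)) (γ : Finset (Fin (2*k+2))) :
    (Matrix.of fun (p : {p // p ∈ γ}) (v : Fin (k+2)) =>
        ((if (E p.1).1 = v then (1:ℚ) else 0) - (if (E p.1).2 = v then (1:ℚ) else 0))).rank ≤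
      (reducedIncidence ℚ E).rank := by
  set Q : Matrix (Fin (k+1)) (Fin (k+2)) ℚ :=
    Matrix.of fun j v => if v = 0 then (-1 : ℚ) else if v = j.succ then 1 else 0 with hQ
  have hfac : (Matrix.of fun (p : {p // p ∈ γ}) (v : Fin (k+2)) =>
        ((if (E p.1).1 = v then (1:ℚ) else 0) - (if (E p.1).2 = v then (1:ℚ) else 0))) =
      (reducedIncidence ℚ E).submatrix (fun p : {p // p ∈ γ} => p.1) id * Q := by
    ext p v
    rw [Matrix.mul_apply]
    simp only [Matrix.submatrix_apply, id_eq, Matrix.of_apply, reducedIncidence, hQ]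
    refine Fin.cases ?_ (fun j => ?_) v
    · have h := sum_fullIncidence_row (E p.1).1 (E p.1).2
      rw [Fin.sum_univ_succ] at h
      simp only [if_true, mul_neg, mul_one, Finset.sum_neg_distrib]
      linarith
    · have hj0 : (j.succ : Fin (k+2)) ≠ 0 := Fin.succ_ne_zero j
      simp only [hj0, if_false, Fin.succ_inj, mul_ite, mul_one, mul_zero]
      rw [Finset.sum_ite_eq]
      simp
  rw [hfac]
  exact (Matrix.rank_mul_le_left _ _).trans (Matrix.rank_submatrix_le _ _ _)

/-- The last-flag condition of the inlined Hepp sum forces connectivity: if `γ = univ` and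
`|γ| - rk F_γ = k + 1`, then `rk ℰ_E = k + 1`. [folklore] -/
theorem isConnectedEdgeList_of_card_sub_rank (E : Fin (2*k+2) → Fin (k+2) × Fin (k+2))
    (γ : Finset (Fin (2*k+2))) (hγ : γ = Finset.univ)
    (h : γ.card - (Matrix.of fun (p : {p // p ∈ γ}) (v : Fin (k+2)) =>
        ((if (E p.1).1 = v then (1:ℚ) else 0) - (if (E p.1).2 = v then (1:ℚ) else 0))).rank = k + 1) :
    IsConnectedEdgeList E := by
  have hle := rank_fullRows_le E γ
  have hw : (reducedIncidence ℚ E).rank ≤ k + 1 := Matrix.rank_le_width _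
  have hcard : γ.card = 2 * k + 2 := by rw [hγ, Finset.card_univ, Fintype.card_fin]
  show (reducedIncidence ℚ E).rank = k + 1
  omega

/-- **The inlined Hepp sum of a disconnected list vanishes**: no `c` satisfies the flag condition,
whose last clause needs `rk = k+1`. (Panzer2022 Thm 2.19 is the matroid statement; here it is
immediate from the typing.) [cite: Panzer2022, Thm 2.19] -/
theorem inlineHepp_eq_zero_of_not_connected (k : ℕ) (E : Fin (2*k+2) → Fin (k+2) × Fin (k+2))
    (hE : ¬ IsConnectedEdgeList E) :
    (∑ c : Fin (k+1) → Finset (Fin (2*k+2)), if ((∀ i : Fin (k+1), (c i).Nonempty ∧ (∀ e ∈ c i,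
        (Matrix.of fun (p : {p // p ∈ (c i).erase e}) (v : Fin (k+2)) => ((if (E p.1).1 = v then (1:ℚ) else
        0) - (if (E p.1).2 = v then (1:ℚ) else 0))).rank = (Matrix.of fun (p : {p // p ∈ c i}) (v : Fin
        (k+2)) => ((if (E p.1).1 = v then (1:ℚ) else 0) - (if (E p.1).2 = v then (1:ℚ) else 0))).rank) ∧ (c
        i).card - (Matrix.of fun (p : {p // p ∈ c i}) (v : Fin (k+2)) => ((if (E p.1).1 = v then (1:ℚ) else
        0) - (if (E p.1).2 = v then (1:ℚ) else 0))).rank = i.val + 1) ∧ (∀ i j : Fin (k+1), i < j → c i ⊂ c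
        j) ∧ c (Fin.last k) = Finset.univ) then ((c 0).card : ℚ) * (∏ i : Fin k, (((c i.succ).card : ℚ) -
        ((c i.castSucc).card : ℚ))) / (∏ i : Fin k, (((c i.castSucc).card : ℚ) - 2 * ((i.val : ℚ) + 1)))
        else 0) = 0 := by
  refine Finset.sum_eq_zero fun c _ => ?_
  split_ifs with hcond
  · exact absurd (isConnectedEdgeList_of_card_sub_rank E (c (Fin.last k)) hcond.2.2
      (by simpa only [Fin.val_last] using (hcond.1 (Fin.last k)).2.2)) hE
  · rfl

/-- Euler: a connected list with `2k+2` edges on `k+2` vertices has `h₁ = k+1`, i.e. it is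
logarithmically divergent in `D = 4`, `|E| = 2 h₁(E)`. [cite: Brown2009FeynmanPeriods, §1.1 (Euler's formula)] -/
theorem two_mul_loopNumber_univ (E : Fin (2*k+2) → Fin (k+2) × Fin (k+2))
    (hc : IsConnectedEdgeList E) : 2 * k + 2 = 2 * loopNumber E Finset.univ := by
  have hr : (reducedIncidence ℚ E).rank = k + 1 := hc
  unfold loopNumber
  rw [edgeRank_univ, hr, Finset.card_univ, Fintype.card_fin]
  omega

/-- **Positivity of the Hepp bound on the primitive locus** (Panzer2022 §2.5: inside the convergence
cone the Hepp integral has a positive integrand; here directly from Def. 2.4): every one of the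
`(2k+2)!` sector terms is a product of inverses of POSITIVE superficial degrees of convergence
`ω(γ) = |γ| - 2h₁(γ)` of non-empty proper prefix sets (`graphSdc_four_one_pos`). [cite: Panzer2022, §2.5 and Def. 2.4] -/
theorem graphUnitHeppBound_pos (E : Fin (2*k+2) → Fin (k+2) × Fin (k+2))
    (hp : IsPrimitiveDivergent E) : 0 < graphUnitHeppBound E := by
  rw [graphUnitHeppBound, graphHeppBoundDim_eq]
  refine Finset.sum_pos (fun l hl => Finset.prod_pos fun i hi => inv_pos.2 ?_) ?_
  · rw [Finset.mem_Ico] at hi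
    have hlen : l.length = 2 * k + 2 := by
      have h := congr_arg Multiset.card (mem_orderings_iff.mp hl)
      simpa using h
    refine graphSdc_four_one_pos E hp _ ?_ ?_
    · rw [List.toFinset_nonempty_iff]
      intro hnil
      rw [List.take_eq_nil_iff] at hnil
      rcases hnil with h0 | h0
      · omega
      · rw [h0] at hlen
        simp at hlen
    · intro hu
      have h1 : (l.take i).toFinset.card ≤ (l.take i).length := List.toFinset_card_le _
      rw [hu, Finset.card_univ, Fintype.card_fin, List.length_take] at h1
      omega
  · exact ⟨(Finset.univ : Finset (Fin (2*k+2))).val.toList, mem_orderings_iff.mpr (by simp)⟩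

end Hepp

/-! ## §4 The composition (sorry-free): reduction to the primitive locus inside the calculus -/

/-- **The composition, unfolded form**: no-subdivergence (stub 1) → calibration (stub 2) → lifting on
primitive φ⁴ graphs (stub 3) → the crux `TropicalLifting` UNFOLDED VERBATIM (text copied from the route
file `Theses/PhiFourHepp.lean`; `TropicalLifting_of` below restates the conclusion by its route name).
Four-way case analysis on connectivity; see the module docstring, (a)–(e). [folklore] -/
theorem TropicalLifting_unfolded_of :
    NoSubdivergenceOfIntegrable → InlineHeppCalibration → PrimitiveLifting →
      ∀ (k₁ k₂ : ℕ) (E₁ : Fin (2*k₁+2) → Fin (k₁+2) × Fin (k₁+2)) (E₂ : Fin (2*k₂+2) → Fin (k₂+2) × Fin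
      (k₂+2)), (∀ v, (Finset.univ.filter fun e => (E₁ e).1 = v ∨ (E₁ e).2 = v).card ≤ 4) → (∀ v,
      (Finset.univ.filter fun e => (E₂ e).1 = v ∨ (E₂ e).2 = v).card ≤ 4) → ∀ (r₁ :
      Literature.NumberTheory.Transcendental.KZ.IntegralRep (2*k₁+1)) (r₂ :
      Literature.NumberTheory.Transcendental.KZ.IntegralRep (2*k₂+1)), r₁.domain = {x | ∀ j, 0 < x j} →
      Set.EqOn r₁.integrand (fun x => 1 / ((Matrix.fromBlocks (Matrix.diagonal (Fin.snoc x (1:ℝ) : Fin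
      (2*k₁+2) → ℝ)) (Matrix.of fun (e : Fin (2*k₁+2)) (j : Fin (k₁+1)) => ((if (E₁ e).1 = j.succ then
      (1:ℝ) else 0) - (if (E₁ e).2 = j.succ then (1:ℝ) else 0))) (-(Matrix.of fun (e : Fin (2*k₁+2)) (j :
      Fin (k₁+1)) => ((if (E₁ e).1 = j.succ then (1:ℝ) else 0) - (if (E₁ e).2 = j.succ then (1:ℝ) else
      0))).transpose) (0 : Matrix (Fin (k₁+1)) (Fin (k₁+1)) ℝ)).det) ^ 2) r₁.domain → r₂.domain = {x | ∀
      j, 0 < x j} → Set.EqOn r₂.integrand (fun x => 1 / ((Matrix.fromBlocks (Matrix.diagonal (Fin.snoc x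
      (1:ℝ) : Fin (2*k₂+2) → ℝ)) (Matrix.of fun (e : Fin (2*k₂+2)) (j : Fin (k₂+1)) => ((if (E₂ e).1 =
      j.succ then (1:ℝ) else 0) - (if (E₂ e).2 = j.succ then (1:ℝ) else 0))) (-(Matrix.of fun (e : Fin
      (2*k₂+2)) (j : Fin (k₂+1)) => ((if (E₂ e).1 = j.succ then (1:ℝ) else 0) - (if (E₂ e).2 = j.succ then
      (1:ℝ) else 0))).transpose) (0 : Matrix (Fin (k₂+1)) (Fin (k₂+1)) ℝ)).det) ^ 2) r₂.domain → (∑ c :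
      Fin (k₁+1) → Finset (Fin (2*k₁+2)), if ((∀ i : Fin (k₁+1), (c i).Nonempty ∧ (∀ e ∈ c i, (Matrix.of
      fun (p : {p // p ∈ (c i).erase e}) (v : Fin (k₁+2)) => ((if (E₁ p.1).1 = v then (1:ℚ) else 0) - (if
      (E₁ p.1).2 = v then (1:ℚ) else 0))).rank = (Matrix.of fun (p : {p // p ∈ c i}) (v : Fin (k₁+2)) =>
      ((if (E₁ p.1).1 = v then (1:ℚ) else 0) - (if (E₁ p.1).2 = v then (1:ℚ) else 0))).rank) ∧ (c i).card
      - (Matrix.of fun (p : {p // p ∈ c i}) (v : Fin (k₁+2)) => ((if (E₁ p.1).1 = v then (1:ℚ) else 0) -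
      (if (E₁ p.1).2 = v then (1:ℚ) else 0))).rank = i.val + 1) ∧ (∀ i j : Fin (k₁+1), i < j → c i ⊂ c j)
      ∧ c (Fin.last k₁) = Finset.univ) then ((c 0).card : ℚ) * (∏ i : Fin k₁, (((c i.succ).card : ℚ) - ((c
      i.castSucc).card : ℚ))) / (∏ i : Fin k₁, (((c i.castSucc).card : ℚ) - 2 * ((i.val : ℚ) + 1))) else
      0) = (∑ c : Fin (k₂+1) → Finset (Fin (2*k₂+2)), if ((∀ i : Fin (k₂+1), (c i).Nonempty ∧ (∀ e ∈ c i,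
      (Matrix.of fun (p : {p // p ∈ (c i).erase e}) (v : Fin (k₂+2)) => ((if (E₂ p.1).1 = v then (1:ℚ)
      else 0) - (if (E₂ p.1).2 = v then (1:ℚ) else 0))).rank = (Matrix.of fun (p : {p // p ∈ c i}) (v :
      Fin (k₂+2)) => ((if (E₂ p.1).1 = v then (1:ℚ) else 0) - (if (E₂ p.1).2 = v then (1:ℚ) else
      0))).rank) ∧ (c i).card - (Matrix.of fun (p : {p // p ∈ c i}) (v : Fin (k₂+2)) => ((if (E₂ p.1).1 =
      v then (1:ℚ) else 0) - (if (E₂ p.1).2 = v then (1:ℚ) else 0))).rank = i.val + 1) ∧ (∀ i j : Fin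
      (k₂+1), i < j → c i ⊂ c j) ∧ c (Fin.last k₂) = Finset.univ) then ((c 0).card : ℚ) * (∏ i : Fin k₂,
      (((c i.succ).card : ℚ) - ((c i.castSucc).card : ℚ))) / (∏ i : Fin k₂, (((c i.castSucc).card : ℚ) - 2
      * ((i.val : ℚ) + 1))) else 0) → Literature.NumberTheory.Transcendental.KZ.Equivalent r₁ r₂ := by
  intro h1' h2' h3' k₁ k₂ E₁ E₂ hd₁ hd₂ r₁ r₂ hdom₁ hint₁ hdom₂ hint₂ hH
  -- (0) open the three named stub statements
  have h1 : ∀ (k : ℕ) (E : Fin (2*k+2) → Fin (k+2) × Fin (k+2)),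
      IsConnectedEdgeList E →
      IntegrableOn (graphPeriodIntegrand E) (openOrthant (2*k+1)) →
      ∀ γ : Finset (Fin (2*k+2)), γ.Nonempty → γ ≠ Finset.univ → 2 * loopNumber E γ < γ.card := h1'
  have h2 : ∀ (k : ℕ) (E : Fin (2*k+2) → Fin (k+2) × Fin (k+2)),
      IsConnectedEdgeList E →
      (∑ c : Fin (k+1) → Finset (Fin (2*k+2)), if ((∀ i : Fin (k+1), (c i).Nonempty ∧ (∀ e ∈ c i,
        (Matrix.of fun (p : {p // p ∈ (c i).erase e}) (v : Fin (k+2)) => ((if (E p.1).1 = v then (1:ℚ) else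
        0) - (if (E p.1).2 = v then (1:ℚ) else 0))).rank = (Matrix.of fun (p : {p // p ∈ c i}) (v : Fin
        (k+2)) => ((if (E p.1).1 = v then (1:ℚ) else 0) - (if (E p.1).2 = v then (1:ℚ) else 0))).rank) ∧ (c
        i).card - (Matrix.of fun (p : {p // p ∈ c i}) (v : Fin (k+2)) => ((if (E p.1).1 = v then (1:ℚ) else
        0) - (if (E p.1).2 = v then (1:ℚ) else 0))).rank = i.val + 1) ∧ (∀ i j : Fin (k+1), i < j → c i ⊂ c
        j) ∧ c (Fin.last k) = Finset.univ) then ((c 0).card : ℚ) * (∏ i : Fin k, (((c i.succ).card : ℚ) -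
        ((c i.castSucc).card : ℚ))) / (∏ i : Fin k, (((c i.castSucc).card : ℚ) - 2 * ((i.val : ℚ) + 1)))
        else 0)
        = graphUnitHeppFlagSum E := h2'
  have h3 : ∀ (k₁ k₂ : ℕ) (E₁ : Fin (2*k₁+2) → Fin (k₁+2) × Fin (k₁+2))
      (E₂ : Fin (2*k₂+2) → Fin (k₂+2) × Fin (k₂+2)),
      IsPhiFour E₁ → IsPhiFour E₂ →
      IsConnectedEdgeList E₁ → IsPrimitiveDivergent E₁ →
      IsConnectedEdgeList E₂ → IsPrimitiveDivergent E₂ →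
      ∀ (r₁ : Literature.NumberTheory.Transcendental.KZ.IntegralRep (2*k₁+1))
        (r₂ : Literature.NumberTheory.Transcendental.KZ.IntegralRep (2*k₂+1)),
        r₁.domain = openOrthant (2*k₁+1) →
        Set.EqOn r₁.integrand (graphPeriodIntegrand E₁) r₁.domain →
        r₂.domain = openOrthant (2*k₂+1) →
        Set.EqOn r₂.integrand (graphPeriodIntegrand E₂) r₂.domain →
        graphUnitHeppBound E₁ = graphUnitHeppBound E₂ →
        Literature.NumberTheory.Transcendental.KZ.Equivalent r₁ r₂ := h3'
  clear h1' h2' h3'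
  -- (1) integrability of the graph integrand, read off the representation
  have hI : ∀ {k : ℕ} (E : Fin (2*k+2) → Fin (k+2) × Fin (k+2))
      (r : Literature.NumberTheory.Transcendental.KZ.IntegralRep (2*k+1)),
      r.domain = openOrthant (2*k+1) → Set.EqOn r.integrand (graphPeriodIntegrand E) r.domain →
      IntegrableOn (graphPeriodIntegrand E) (openOrthant (2*k+1)) := by
    intro k E r hd hi
    rw [← hd]
    exact r.integrableOn.congr_fun hi (IntegralRep.measurableSet_domain_holds r)
  -- (2) connected + convergent ⇒ primitive divergent (Euler + stub 1)
  have hprim : ∀ {k : ℕ} (E : Fin (2*k+2) → Fin (k+2) × Fin (k+2))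
      (r : Literature.NumberTheory.Transcendental.KZ.IntegralRep (2*k+1)),
      IsConnectedEdgeList E → r.domain = openOrthant (2*k+1) →
      Set.EqOn r.integrand (graphPeriodIntegrand E) r.domain → IsPrimitiveDivergent E :=
    fun E r hc hd hi => ⟨two_mul_loopNumber_univ E hc, h1 _ E hc (hI E r hd hi)⟩
  -- (3) disconnected ⇒ the pinned representation is a relation (integrand `1/0² = 0` on the domain)
  have hzero : ∀ {k : ℕ} (E : Fin (2*k+2) → Fin (k+2) × Fin (k+2))
      (r : Literature.NumberTheory.Transcendental.KZ.IntegralRep (2*k+1)),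
      ¬ IsConnectedEdgeList E → Set.EqOn r.integrand (graphPeriodIntegrand E) r.domain →
      of r ∈ relations :=
    fun E r hc hi => of_mem_relations_of_eqOn_zero r fun x hx => by
      rw [hi hx]
      exact graphPeriodIntegrand_eq_zero_of_not_connected E hc x
  -- (4) four-way case analysis on connectivity
  by_cases hc₁ : IsConnectedEdgeList E₁ <;> by_cases hc₂ : IsConnectedEdgeList E₂
  · -- both connected: primitive by (2); Hepp sums calibrated (stub 2 + Prop. 3.2); lift (stub 3)
    have hp₁ : IsPrimitiveDivergent E₁ := hprim E₁ r₁ hc₁ hdom₁ hint₁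
    have hp₂ : IsPrimitiveDivergent E₂ := hprim E₂ r₂ hc₂ hdom₂ hint₂
    have t₁ : graphUnitHeppBound E₁ = graphUnitHeppFlagSum E₁ :=
      graphUnitHeppBound_eq_graphUnitHeppFlagSum E₁ hp₁
    have t₂ : graphUnitHeppBound E₂ = graphUnitHeppFlagSum E₂ :=
      graphUnitHeppBound_eq_graphUnitHeppFlagSum E₂ hp₂
    rw [h2 k₁ E₁ hc₁, h2 k₂ E₂ hc₂, ← t₁, ← t₂] at hH
    exact h3 k₁ k₂ E₁ E₂ hd₁ hd₂ hc₁ hp₁ hc₂ hp₂ r₁ r₂ hdom₁ hint₁ hdom₂ hint₂ hH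
  · -- E₁ connected, E₂ not: `0 < H(E₁) = inlined(E₁) = inlined(E₂) = 0`
    exfalso
    have hp₁ : IsPrimitiveDivergent E₁ := hprim E₁ r₁ hc₁ hdom₁ hint₁
    have hpos := graphUnitHeppBound_pos E₁ hp₁
    have t₁ : graphUnitHeppBound E₁ = graphUnitHeppFlagSum E₁ :=
      graphUnitHeppBound_eq_graphUnitHeppFlagSum E₁ hp₁
    rw [h2 k₁ E₁ hc₁, inlineHepp_eq_zero_of_not_connected k₂ E₂ hc₂, ← t₁] at hH
    rw [hH] at hpos
    exact lt_irrefl _ hpos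
  · -- E₂ connected, E₁ not: symmetric
    exfalso
    have hp₂ : IsPrimitiveDivergent E₂ := hprim E₂ r₂ hc₂ hdom₂ hint₂
    have hpos := graphUnitHeppBound_pos E₂ hp₂
    have t₂ : graphUnitHeppBound E₂ = graphUnitHeppFlagSum E₂ :=
      graphUnitHeppBound_eq_graphUnitHeppFlagSum E₂ hp₂
    rw [h2 k₂ E₂ hc₂, inlineHepp_eq_zero_of_not_connected k₁ E₁ hc₁, ← t₂] at hH
    rw [← hH] at hpos
    exact lt_irrefl _ hpos
  · -- both disconnected: both representations are relations
    exact relations.sub_mem (hzero E₁ r₁ hc₁ hint₁) (hzero E₂ r₂ hc₂ hint₂)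

/-- **The composition** (sorry-free, closed; concludes the crux BY NAME): `NoSubdivergenceOfIntegrable →
InlineHeppCalibration → PrimitiveLifting → TropicalLifting`, by the verbatim-unfolded
`TropicalLifting_unfolded_of` (the route decl unfolds definitionally to its text).  Its three hypotheses are
exactly the `@[stub "birth"]` statements of §1, each by name. [folklore] -/
theorem TropicalLifting_of :
    NoSubdivergenceOfIntegrable → InlineHeppCalibration → PrimitiveLifting → TropicalLifting :=
  fun h₁ h₂ h₃ => TropicalLifting_unfolded_of h₁ h₂ h₃

/-- **Registered target of the skeleton** — the crux BY NAME with NO hypotheses: `TropicalLifting_of` applied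
to the three declared stubs (the sorries live in `stub_*` only; `#print axioms` of this theorem reaches
`sorryAx` exactly through them, so it is NOT a proof of the item and closes nothing until the stubs land).
`#h21_check_skeleton` keys on THIS theorem: among the theorems of the file concluding the crux by name it
is enumerated first (checked: `TropicalLifting_ofStubs`, then `TropicalLifting_of`), and it takes no
hypotheses, so the audit passes in the tree copy, where the `@[stub "birth"]` tags of §1 are necessarily
comments (gate-reserved attribute, refused in crux workfiles); with the tags live (registrar's work copy
`bc/TropicalLifting_birth_tagged.lean`) `TropicalLifting_of` passes as well, its three hypotheses being the
stub statements by name. -/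
theorem TropicalLifting_ofStubs : TropicalLifting :=
  TropicalLifting_of stub_noSubdivergence_of_integrable stub_inlineHepp_eq_flagSum stub_lifting_primitive

end Summit.KontsevichZagierPeriods.KontsevichZagierPeriods.Cruxes.TropicalLifting.Birth
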